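import Literature.Computability.AlgebraicComplexity.SchoenhageTauBini

/-!
# Stub `stub_borderRankExponent` of crux `CondensationDistance.DerivationsBoundOmega`
# (stmt-MatrixMultiplication-15940), line `birth`

Bini's theorem in exponent form: a bound `bR(⟨q,q,q⟩) ≤ A · q^τ` on the algebraic border rank
(`algBorderRank`, Bläser 2013 Def. 6.1) of square matrix multiplication for all large `q` gives
`omega ℂ ≤ τ` for the tree's rank exponent `omega`.

Proof: for `ε > 0` pick `q ≥ max q₀ 2` with `log q ≥ log (2M) / ε`, `M := max A 1`; with
`r := ⌈M q^τ⌉₊ ≥ 1`, Bläser's Thm. 6.6 in cubic form (PROVED in tree: `Blaser2013_thm66_holds`,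
`Blaser2013_thm66.cubic`) gives `omega ℂ ≤ log_q r`. If `M q^τ ≥ 1` then `r ≤ 2 M q^τ` and
`log_q r ≤ log (2M) / log q + τ ≤ ε + τ`; if `M q^τ < 1` then `r = 1` and `omega ℂ ≤ 0` contradicts
`omega_two_le`. Hence `omega ℂ ≤ τ + ε` for every `ε > 0`.

Target tree file:
`Summits/MatrixMultiplication/MatrixMultiplication/Theorems/CondensationDistanceDerivationsBoundOmegaStubBorderRankExponent.lean`
(helper for the crux, landed with `--supports stmt-MatrixMultiplication-15940`); the theorem keeps
EXACTLY the registered name and signature of the skeleton `Cruxes/DerivationsBoundOmega/Lines/birth.lean`.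

## References
* D. Bini, Relations between exact and approximate bilinear algorithms. Applications, Calcolo 17
  (1980) 87–97.
* M. Bläser, Fast Matrix Multiplication, Theory of Computing Graduate Surveys 5 (2013), Thm. 6.6.
-/

set_option linter.dupNamespace false

namespace Summit.MatrixMultiplication.MatrixMultiplication.Theorems.DerivationsBoundOmega

open Literature.Computability.AlgebraicComplexity

/-- **Bini's theorem in exponent form** (Bini 1980; Bläser 2013, Thm. 6.6): if the algebraic border
rank of `⟨q,q,q⟩` is at most `A · q^τ` for all large `q`, then `omega ℂ ≤ τ`. Registered stub
`stub_borderRankExponent` of line `birth` of crux `DerivationsBoundOmega`.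
[cite: Blaser2013, Thm. 6.6] -/
theorem stub_borderRankExponent :
    ∀ τ : ℝ, (∃ A : ℝ, ∃ q₀ : ℕ, ∀ q ≥ q₀,
        (algBorderRank (matMulTensor ℂ q q q) : ℝ) ≤ A * (q : ℝ) ^ τ) →
      omega ℂ ≤ τ := by
  rintro τ ⟨A, q₀, hA⟩
  set M : ℝ := max A 1 with hM
  have hM1 : 1 ≤ M := le_max_right _ _
  have hM0 : 0 < M := by linarith
  have h2M : 1 < 2 * M := by linarith
  have hlog2M : 0 < Real.log (2 * M) := Real.log_pos h2M
  refine le_of_forall_pos_le_add fun ε hε => ?_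
  -- a large size `q`
  obtain ⟨q, hq₀, hq2, hqε⟩ :
      ∃ q : ℕ, q₀ ≤ q ∧ 2 ≤ q ∧ Real.exp (Real.log (2 * M) / ε) ≤ q := by
    refine ⟨max (max q₀ 2) ⌈Real.exp (Real.log (2 * M) / ε)⌉₊, ?_, ?_, ?_⟩
    · exact (le_max_left _ _).trans (le_max_left _ _)
    · exact (le_max_right _ _).trans (le_max_left _ _)
    · exact (Nat.le_ceil _).trans (by exact_mod_cast le_max_right _ _)
  have hq0 : (0 : ℝ) < q := by exact_mod_cast (by omega : 0 < q)
  have hq1 : (1 : ℝ) < q := by exact_mod_cast (by omega : 1 < q)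
  have hlogq : 0 < Real.log q := Real.log_pos hq1
  have hqτ : 0 < (q : ℝ) ^ τ := Real.rpow_pos_of_pos hq0 τ
  have hbr : (algBorderRank (matMulTensor ℂ q q q) : ℝ) ≤ M * (q : ℝ) ^ τ :=
    (hA q hq₀).trans (mul_le_mul_of_nonneg_right (le_max_left _ _) hqτ.le)
  -- Bini at `r := ⌈M q^τ⌉₊`
  set r : ℕ := ⌈M * (q : ℝ) ^ τ⌉₊ with hr
  have hMq : 0 < M * (q : ℝ) ^ τ := mul_pos hM0 hqτ
  have hr1 : 1 ≤ r := Nat.succ_le_of_lt (Nat.ceil_pos.2 hMq)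
  have hbr' : algBorderRank (matMulTensor ℂ q q q) ≤ r := by
    have : (algBorderRank (matMulTensor ℂ q q q) : ℝ) ≤ r := hbr.trans (Nat.le_ceil _)
    exact_mod_cast this
  have hω := Blaser2013_thm66_holds.cubic ℂ hq2 hr1 hbr'
  rcases lt_or_ge (M * (q : ℝ) ^ τ) 1 with hlt | hle
  · -- degenerate case: `r = 1`, `omega ℂ ≤ log_q 1 = 0`, absurd
    have hr_le : r ≤ 1 := Nat.ceil_le.2 (by exact_mod_cast hlt.le)
    have hr_eq : r = 1 := le_antisymm hr_le hr1
    rw [hr_eq, Nat.cast_one, Real.logb_one] at hω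
    linarith [omega_two_le ℂ]
  · -- main case: `r ≤ 2 M q^τ`
    have hr2 : (r : ℝ) ≤ 2 * M * (q : ℝ) ^ τ := by
      have := Nat.ceil_lt_add_one hMq.le
      linarith
    have hr0 : (0 : ℝ) < r := by exact_mod_cast hr1
    have hlogr : Real.log r ≤ Real.log (2 * M) + τ * Real.log q := by
      have h1 : Real.log r ≤ Real.log (2 * M * (q : ℝ) ^ τ) := Real.log_le_log hr0 hr2
      rwa [Real.log_mul (by positivity) hqτ.ne', Real.log_rpow hq0] at h1
    have hω' : omega ℂ ≤ Real.log r / Real.log q := by rwa [Real.logb] at hω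
    have hεq : Real.log (2 * M) / Real.log q ≤ ε := by
      rw [div_le_iff₀ hlogq]
      have h : Real.log (2 * M) / ε ≤ Real.log q := by
        have h := Real.log_le_log (Real.exp_pos _) hqε
        rwa [Real.log_exp] at h
      rw [div_le_iff₀ hε] at h
      linarith
    calc omega ℂ ≤ Real.log r / Real.log q := hω'
      _ ≤ (Real.log (2 * M) + τ * Real.log q) / Real.log q :=
          div_le_div_of_nonneg_right hlogr hlogq.le
      _ = Real.log (2 * M) / Real.log q + τ := by
          rw [add_div, mul_div_assoc, div_self hlogq.ne', mul_one]
      _ ≤ τ + ε := by linarith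

end Summit.MatrixMultiplication.MatrixMultiplication.Theorems.DerivationsBoundOmega
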